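import Summits.BirchSwinnertonDyer.BirchSwinnertonDyer.Theorems.GenusKolyvaginAtTwoEquivariantKolyvaginExactAtTwoPropFourFourRat
import Summits.BirchSwinnertonDyer.BirchSwinnertonDyer.Theorems.ByReductionTypeAtTwoRankOneAtTwoBigImageOddLocalOneDoorBottomTranspositionCount
import Literature.NumberTheory.GaloisRepresentations.IntegralGaloisActionProofs
import HarnessLib

/-!
# Route ByReductionTypeAtTwo, crux `RankOneAtTwoBigImageOddLocal` (stmt-BirchSwinnertonDyer-23715), LINE v8.11 `one_door_analytic`:
# the `ℚ ⟷ K` dictionary for the STRICT local condition at a TRANSPOSITION prime (level `2`, NO sign of `Δ`)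

Lead prover seat `bsd-line-fkl-p1` g13 (2026-08-28), `--supports stmt-BirchSwinnertonDyer-23715` (helper).  THEOREMS ONLY; no definition, no
named fact introduced, no `sorry`; BSD is not proved by any of this.

Route GenusKolyvaginAtTwo's dictionary `SelmerDescent.zsmul_mem_torsionLocalKer_iff_resTorsion(_of_notMem)` — `(c'·x)_ℓ = 0` in `H¹(ℚ_ℓ, E[2^M])`
iff `(c'·res x)_λ = 0` in `H¹(K_λ, E[2^M])` at an inert `ℓ` — is typed for GROSS primes (`Frob_ℓ = Frob_∞` on `ℚ(E[2^M])`, `Δ(E) < 0`), the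
sign and the Frobenius class entering ONLY through the regular structure `E[2^M] = ℤP ⊕ ℤ·FP` of a Frobenius `F` at `ℓ` acting as a complex
conjugation (`exists_regular_generator_of_Δ_neg`).  At level `M = 1` the same structure holds at every TRANSPOSITION prime — an odd good `ℓ`
with `(Δ_min/ℓ) = −1`, i.e. `Frob_ℓ` an odd permutation of `E[2] ∖ 0` (`sign_permGal_eq_legendreSym_of_isArithFrobAt`, width seat fkl-p2 g10):
it swaps two of the three points and `E[2] = 𝔽₂ P ⊕ 𝔽₂ FP` for either moved point `P` — whatever the sign of `Δ(E)`.  These are the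
REGULAR Kolyvagin primes of the `Δ_W > 0` bottom rung (`KolPos`, MEMO-es §18.11), where Gross's primes do not exist at `M = 2`.

* §1 `exists_regular_generator_two_of_smul_ne` — `E[2] = ℤv ⊕ ℤ·Fv` freely over `ℤ/2` for ANY `F ∈ Γ_ℚ` and any `v ∈ E[2]` with `Fv ≠ v`.
* §2 `regular_two_of_sign_permGal_eq_neg_one` — for `F` with `sign(permGal F) = −1`: `F² = 1` on `E[2]` and the regular structure.
* §3 `zsmul_mem_torsionLocalKer_iff_resTorsion_of_jacobiSym` (+ `_of_notMem`) — **the dictionary at a transposition prime**, `q = 2^1`,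
  `K = ℚ(θ)` quadratic with `θ² = c`, `ℓ` odd good inert (`f(λ|ℓ) = 2`), `(Δ_min/ℓ) = −1`: `c'·x ∈ torsionLocalKer_ℓ(E/ℚ) ⟺ c'·res x ∈
  torsionLocalKer_λ(E/K)` — gk2-p3's proof VERBATIM with Step 2 (the regular structure) supplied by §2 for an arithmetic Frobenius at `ℓ`
  (`exists_isArithFrobAt_of_mem_primesAbove_holds`).
* §4 `zsmul_twist_mem_selmerLocalKer_iff_zsmul_mem_torsionLocalKer_of_K_of_jacobiSym` — the CROSS field `c_mem_loc_iff₁₂` over `ℚ` at a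
  transposition prime from the `K`-relation (composition as in `…PropFourFourRat`).

References: [McCallumLMS1991] §3 (3), §4 Prop. 4.4; [GrossLMS1991] §3 (3.2), §4, Prop. 9.6; [Kramer1981] Prop. 3; [MazurRubin2010] Lemma 2.2;
[NeukirchANT1999] I §9 (9.4)–(9.6); [SerreGaloisCohomology1997] I §2.6 (b); [SilvermanAEC2009] III.6.4 (b), III.§7.
-/

set_option autoImplicit false
-- the Theorems namespace of this sub repeats the summit name by design (D-0017 nested layout)
set_option linter.dupNamespace false

noncomputable section

open scoped Classical Pointwise

namespace Summit.BirchSwinnertonDyer.BirchSwinnertonDyer.Theorems.RankOneAtTwoOneDoor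

open WeierstrassCurve NumberField IsDedekindDomain Field
  Literature.NumberTheory.EllipticCurves Literature.NumberTheory.GaloisRepresentations
  Literature.NumberTheory.EllipticCurves.DokchitserDokchitser2012
  Summit.BirchSwinnertonDyer.BirchSwinnertonDyer.Theorems.GenusExact
  Summit.BirchSwinnertonDyer.BirchSwinnertonDyer.Theorems.GenusExact.FrobeniusCriterion
  Summit.BirchSwinnertonDyer.BirchSwinnertonDyer.Theorems.GenusExact.SelmerDescent
  Summit.BirchSwinnertonDyer.BirchSwinnertonDyer.Theorems.GenusExact.EigenClassesFinite

/-! ### §1 The regular structure of `E[2]` over `ℤ/2[F]` from one moved point -/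

/-- **`E[2] = ℤv ⊕ ℤ·Fv` freely over `ℤ/2`** for any `F ∈ Γ_ℚ` and any `2`-torsion point `v` with `Fv ≠ v` (independence:
gk2's `pow_dvd_of_zsmul_add_zsmul_smul_eq_zero` at `M = 1`; generation by counting `#E[2] = 4`).  The `M = 1` case of route GenusKolyvaginAtTwo's
`exists_regular_generator_of_Δ_neg`, with no sign hypothesis. [cite: SilvermanAEC2009, Cor. III.6.4 (b)] [cite: GrossLMS1991, §4] -/
theorem exists_regular_generator_two_of_smul_ne (W : WeierstrassCurve ℚ) [W.IsElliptic] (F : absoluteGaloisGroup ℚ)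
    (v : geomTorsion W ((2 ^ 1 : ℕ) : ℤ)) (hv : F • v ≠ v) :
    ∃ P : geomTorsion W ((2 ^ 1 : ℕ) : ℤ), (2 : ℤ) ^ 1 • P = 0 ∧
      (∀ Q : geomTorsion W ((2 ^ 1 : ℕ) : ℤ), ∃ x y : ℤ, Q = x • P + y • F • P) ∧
      (∀ x y : ℤ, x • P + y • F • P = 0 → (2 : ℤ) ^ 1 ∣ x ∧ (2 : ℤ) ^ 1 ∣ y) := by
  have hv2' : ((2 ^ 1 : ℕ) : ℤ) • (v : geomPoints W) = 0 := (mem_geomTorsion_iff W _ (v : geomPoints W)).mp v.2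
  have hv2 : (2 : ℤ) • (v : geomPoints W) = 0 :=
    calc (2 : ℤ) • (v : geomPoints W) = ((2 ^ 1 : ℕ) : ℤ) • (v : geomPoints W) := by norm_num
      _ = 0 := hv2'
  have hcv : F • (v : geomPoints W) ≠ (v : geomPoints W) := fun h ↦ hv (Subtype.ext h)
  have hPM' : (2 : ℤ) ^ 1 • (v : geomPoints W) = 0 := by rw [pow_one]; exact hv2
  have hP₀M : (2 : ℤ) ^ 1 • v = 0 := Subtype.ext (by
    rw [AddSubgroupClass.coe_zsmul, ZeroMemClass.coe_zero]; exact hPM')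
  have hfree : ∀ a b : ℤ, a • v + b • F • v = 0 → (2 : ℤ) ^ 1 ∣ a ∧ (2 : ℤ) ^ 1 ∣ b := by
    intro a b hab
    have hab' : a • (v : geomPoints W) + b • (F • (v : geomPoints W)) = 0 := congrArg Subtype.val hab
    exact pow_dvd_of_zsmul_add_zsmul_smul_eq_zero hv2 hcv 1 (v : geomPoints W) hPM' (by rw [pow_zero, one_zsmul]) a b hab'
  refine ⟨v, hP₀M, ?_, hfree⟩
  -- generation by counting
  let g : ZMod 2 × ZMod 2 → geomTorsion W ((2 ^ 1 : ℕ) : ℤ) := fun ab ↦ (ab.1.val : ℤ) • v + (ab.2.val : ℤ) • F • v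
  have hmod : ∀ {x y : ZMod 2}, ((2 : ℤ) ^ 1) ∣ (x.val : ℤ) - y.val → x = y := by
    intro x y hxy
    apply ZMod.val_injective 2
    have hxy' : (((2 : ℕ) : ℕ) : ℤ) ∣ (x.val : ℤ) - y.val := by simpa using hxy
    exact ((Nat.modEq_iff_dvd.mpr hxy').eq_of_lt_of_lt (ZMod.val_lt y) (ZMod.val_lt x)).symm
  have hinj : Function.Injective g := by
    rintro ⟨a, b⟩ ⟨a', b'⟩ h
    have h' : ((a.val : ℤ) - a'.val) • v + ((b.val : ℤ) - b'.val) • F • v = 0 := by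
      simp only [g] at h
      rw [sub_zsmul, sub_zsmul, ← sub_eq_zero.mpr h]
      abel
    obtain ⟨ha, hb⟩ := hfree _ _ h'
    exact Prod.ext (hmod ha) (hmod hb)
  have hcardT : Nat.card (geomTorsion W ((2 ^ 1 : ℕ) : ℤ)) = (2 ^ 1) ^ 2 :=
    card_torsionPoints_eq_sq_holds W (AlgebraicClosure ℚ) (n := 2 ^ 1) (by norm_num)
  haveI : Finite (geomTorsion W ((2 ^ 1 : ℕ) : ℤ)) := Nat.finite_of_card_ne_zero (by rw [hcardT]; norm_num)
  have hle : Nat.card (geomTorsion W ((2 ^ 1 : ℕ) : ℤ)) ≤ Nat.card (ZMod 2 × ZMod 2) := by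
    rw [hcardT, Nat.card_prod, Nat.card_zmod]; norm_num
  have hbij : Function.Bijective g := hinj.bijective_of_nat_card_le hle
  intro Q
  obtain ⟨⟨a, b⟩, hab⟩ := hbij.2 Q
  exact ⟨(a.val : ℤ), (b.val : ℤ), hab.symm⟩

/-! ### §2 A Galois element acting on `E[2]` as a transposition -/

/-- An odd permutation of three letters is an involution. [folklore] -/
theorem perm_three_mul_self_of_sign_eq_neg_one (g : Equiv.Perm (Fin 3)) (hg : Equiv.Perm.sign g = -1) : g * g = 1 := by
  revert hg; revert g; decide

/-- An odd permutation of three letters moves some letter. [folklore] -/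
theorem perm_three_exists_ne_of_sign_eq_neg_one (g : Equiv.Perm (Fin 3)) (hg : Equiv.Perm.sign g = -1) : ∃ i, g i ≠ i := by
  revert hg; revert g; decide

/-- **A Galois element whose permutation of `E[2] ∖ 0` is ODD acts on `E[2]` as a transposition**: `F² = 1` on `E[2]` and `E[2] = ℤP ⊕ ℤ·FP`
freely over `ℤ/2` for a moved point `P` (level written `((2 ^ 1 : ℕ) : ℤ)`, the level of Kolyvagin's first-layer classes).
[cite: SilvermanAEC2009, III.§7 and Cor. III.6.4 (b)] -/
theorem regular_two_of_sign_permGal_eq_neg_one (W : WeierstrassCurve ℚ) [W.IsElliptic] (F : absoluteGaloisGroup ℚ)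
    (hsign : Equiv.Perm.sign (permGal W (two_ne_zero : (2 : ℚ) ≠ 0) F) = -1) :
    (∀ Q : geomTorsion W ((2 ^ 1 : ℕ) : ℤ), F • F • Q = Q) ∧
      ∃ P : geomTorsion W ((2 ^ 1 : ℕ) : ℤ), (2 : ℤ) ^ 1 • P = 0 ∧
        (∀ Q : geomTorsion W ((2 ^ 1 : ℕ) : ℤ), ∃ x y : ℤ, Q = x • P + y • F • P) ∧
        (∀ x y : ℤ, x • P + y • F • P = 0 → (2 : ℤ) ^ 1 ∣ x ∧ (2 : ℤ) ^ 1 ∣ y) := by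
  set h2 : (2 : ℚ) ≠ 0 := two_ne_zero with hh2
  -- the two levels `2` and `2^1` cut out the same points
  have hmem : ∀ P : geomPoints W, P ∈ geomTorsion W ((2 ^ 1 : ℕ) : ℤ) ↔ P ∈ geomTorsion W 2 := by
    intro P; rw [mem_geomTorsion_iff, mem_geomTorsion_iff]; norm_num
  have hsq : permGal W h2 (F * F) = 1 := by
    rw [permGal_mul]; exact perm_three_mul_self_of_sign_eq_neg_one _ hsign
  refine ⟨fun Q ↦ ?_, ?_⟩
  · -- `F² = 1` on `E[2]`
    apply Subtype.ext
    rw [AddSubgroup.torsionBy.coe_smul, AddSubgroup.torsionBy.coe_smul, ← mul_smul]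
    set Q' : geomTorsion W 2 := ⟨(Q : geomPoints W), (hmem _).mp Q.2⟩ with hQ'
    have hQQ' : (Q : geomPoints W) = (Q' : geomPoints W) := rfl
    rcases eq_zero_or_eq_T W h2 Q' with h0 | ⟨i, hi⟩
    · have : (Q : geomPoints W) = 0 := by rw [hQQ', h0]; rfl
      rw [this, smul_zero]
    · rw [hQQ', hi, ← coe_T_permGal, hsq, Equiv.Perm.one_apply]
  · -- a moved point
    obtain ⟨i, hi⟩ := perm_three_exists_ne_of_sign_eq_neg_one _ hsign
    set v : geomTorsion W ((2 ^ 1 : ℕ) : ℤ) := ⟨(T W h2 i : geomPoints W), (hmem _).mpr (T W h2 i).2⟩ with hvdef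
    have hv : F • v ≠ v := by
      intro h
      have h' : F • (T W h2 i : geomPoints W) = (T W h2 i : geomPoints W) := congrArg Subtype.val h
      rw [← coe_T_permGal] at h'
      exact hi (T_injective W h2 (Subtype.ext h'))
    exact exists_regular_generator_two_of_smul_ne W F v hv

/-! ### §3 The dictionary at a transposition prime -/

section Dictionary

variable (W : WeierstrassCurve ℚ) [W.IsElliptic] [W.IsGloballyMinimal] {K : Type} [Field K] [NumberField K]

/-- **The `ℚ ⟷ K` dictionary for the strict local condition at a TRANSPOSITION prime, level `2`.**  `E = W/ℚ` globally minimal elliptic;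
`K = ℚ(θ)` quadratic, `θ² = c ∈ ℤ`; `ℓ` an odd prime at the place `v` of good reduction, `ℓ ∤ Δ_min`, with `(Δ_min/ℓ) = −1` (Frobenius a
transposition on `E[2]`) and of residue degree `2` in `K` (`λ ∣ v` inert); `x ∈ H¹(ℚ, E[2])` Selmer at `ℓ`.  Then for every `c' ∈ ℤ`:
`c'·x ∈ torsionLocalKer_ℓ(E/ℚ) ⟺ c'·res x ∈ torsionLocalKer_λ(E/K)`.  Proof = route GenusKolyvaginAtTwo's `zsmul_mem_torsionLocalKer_iff_resTorsion`
with the regular structure of an arithmetic Frobenius `F` at `ℓ` supplied by §2 (`sign(permGal F) = (Δ_min/ℓ) = −1`,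
`sign_permGal_eq_legendreSym_of_isArithFrobAt`); no sign of `Δ` is used. [cite: GrossLMS1991, §4 and Prop. 9.6] [cite: McCallumLMS1991, §3 (3), §4 Prop. 4.4]
[cite: Kramer1981, Prop. 3] -/
theorem zsmul_mem_torsionLocalKer_iff_resTorsion_of_jacobiSym {q : ℕ} (hq : q = 2 ^ 1) {ℓ : ℕ} (hℓ : ℓ.Prime) (hℓ2 : ℓ ≠ 2)
    {v : HeightOneSpectrum (𝓞 ℚ)} (hℓv : (ℓ : 𝓞 ℚ) ∈ v.asIdeal) (hgood : W.HasGoodReductionAt v)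
    (hℓΔ : ¬ (ℓ : ℤ) ∣ W.Δ.num) (hjac : jacobiSym W.Δ.num ℓ = -1)
    (h2K : Module.finrank ℚ K = 2) {θ : K} (hθ : θ ∉ (algebraMap ℚ K).range) {c : ℤ} (hc : θ ^ 2 = algebraMap ℚ K c)
    (w : HeightOneSpectrum (𝓞 K)) [w.asIdeal.LiesOver v.asIdeal] (hf : w.asIdeal.inertiaDeg (𝓞 ℚ) = 2)
    {x : galH1Torsion W (q : ℤ)} (hxSel : x ∈ selmerLocalKer W (v.adicCompletion ℚ) (q : ℤ)) (c' : ℤ) :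
    c' • x ∈ W.torsionLocalKer (v.adicCompletion ℚ) (q : ℤ) ↔
      c' • resTorsion W K (q : ℤ) x ∈ (W.baseChange K).torsionLocalKer (w.adicCompletion K) (q : ℤ) := by
  subst hq
  haveI : Fact ℓ.Prime := ⟨hℓ⟩
  haveI : Algebra.IsAlgebraic ℚ K := Algebra.IsAlgebraic.of_finite ℚ K
  -- ### Step 0: bookkeeping at `v` and `w`
  have h2v' : ((2 : ℕ) : 𝓞 ℚ) ∉ v.asIdeal := two_notMem_of_odd_prime_mem hℓ hℓ2 hℓv
  have hqv' : ((2 ^ 1 : ℕ) : 𝓞 ℚ) ∉ v.asIdeal := by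
    rw [Nat.cast_pow]
    exact fun h ↦ h2v' (v.isPrime.mem_of_pow_mem 1 h)
  have hqv : ((((2 ^ 1 : ℕ) : ℤ)) : 𝓞 ℚ) ∉ v.asIdeal := by rwa [Int.cast_natCast]
  have hq0 : (2 ^ 1 : ℕ) ≠ 0 := by norm_num
  have hq0Z : ((2 ^ 1 : ℕ) : ℤ) ≠ 0 := by exact_mod_cast hq0
  have hvbad : v ∉ W.badPlaces (𝓞 ℚ) := fun h ↦ h hgood
  have hwv : w.asIdeal.under (𝓞 ℚ) = v.asIdeal := (Ideal.LiesOver.over (P := w.asIdeal) (p := v.asIdeal)).symm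
  have hgoodK : (W.baseChange K).HasGoodReductionAt w := hasGoodReductionAt_baseChange_of_hasGoodReductionAt W K v w hgood
  have hwbad : w ∉ (W.baseChange K).badPlaces (𝓞 K) := fun h ↦ h hgoodK
  have hqw : ((((2 ^ 1 : ℕ) : ℤ)) : 𝓞 K) ∉ w.asIdeal := intCast_notMem_of_liesOver K v w hqv
  -- ### Step 1: the primes
  obtain ⟨𝔐K, h𝔐K⟩ := w.localPrimesAbove_nonempty
  set 𝔔₀ := w.primeBelow (closureEmb (K := K) (w.adicCompletion K)) 𝔐K with h𝔔₀def
  have h𝔔₀ : 𝔔₀ ∈ w.primesAbove := HeightOneSpectrum.primeBelow_mem_primesAbove h𝔐K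
  set 𝔓₁ := 𝔔₀.comap (absIntegersMap ℚ K) with h𝔓₁def
  have h𝔓₁ : 𝔓₁ ∈ v.primesAbove := comap_absIntegersMap_mem_primesAbove hwv h𝔔₀
  obtain ⟨𝔐, h𝔐⟩ := v.localPrimesAbove_nonempty
  set 𝔓₀ := v.primeBelow (closureEmb (K := ℚ) (v.adicCompletion ℚ)) 𝔐 with h𝔓₀def
  have h𝔓₀ : 𝔓₀ ∈ v.primesAbove := HeightOneSpectrum.primeBelow_mem_primesAbove h𝔐
  haveI : 𝔓₀.IsPrime := h𝔓₀.1
  haveI : 𝔓₁.IsPrime := h𝔓₁.1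
  -- ### Step 2: a Frobenius `F` at `𝔓₁` is a TRANSPOSITION on `E[2]`; regular structure
  obtain ⟨F, hFrob⟩ := IsDedekindDomain.HeightOneSpectrum.exists_isArithFrobAt_of_mem_primesAbove_holds (K := ℚ) (v := v) h𝔓₁
  have hΔ : W.Δ = (W.Δ.num : ℚ) := by
    have hnum : W.Δ.num = minimalDiscriminantInt W := by rw [← cast_minimalDiscriminantInt W, Rat.num_intCast]
    rw [hnum, cast_minimalDiscriminantInt]
  have hsignQ := sign_permGal_eq_legendreSym_of_isArithFrobAt W hΔ hℓ2 hℓΔ hℓv h𝔓₁ hFrob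
  have hleg : legendreSym ℓ W.Δ.num = -1 := by rw [jacobiSym.legendreSym.to_jacobiSym]; exact hjac
  have hsign : Equiv.Perm.sign (permGal W (two_ne_zero : (2 : ℚ) ≠ 0) F) = -1 := by
    rw [hleg] at hsignQ
    rcases Int.units_eq_one_or (Equiv.Perm.sign (permGal W (two_ne_zero : (2 : ℚ) ≠ 0) F)) with h | h
    · rw [h] at hsignQ; norm_num at hsignQ
    · exact h
  obtain ⟨hFF, P, hPM, hgenF, hfreeF⟩ := regular_two_of_sign_permGal_eq_neg_one W F hsign
  have hF2fix : F * F ∈ torsionFixing W ((2 ^ 1 : ℕ) : ℤ) := by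
    rw [mem_torsionFixing_iff]
    intro Q
    rw [mul_smul, hFF]
  -- ### Step 3: `F² = res F'` with `F'` an arithmetic Frobenius at `𝔔₀` fixing `E_K[q]`
  obtain ⟨F', hF'⟩ := sq_mem_range_absGaloisRestrict_of_sq_eq h2K hθ hc F
  have hresF' : absGaloisRestrict ℚ K F' = F * F := hF'
  have hresF'' : resGal (K := ℚ) K F' = F * F := hresF'
  have hFrob' : IsArithFrobAt (𝓞 K) F' 𝔔₀ :=
    isArithFrobAt_of_absGaloisRestrict_eq_pow hwv h𝔔₀ hFrob (by rw [hresF', hf, pow_two])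
  have hF'fix : F' ∈ torsionFixing (W.baseChange K) ((2 ^ 1 : ℕ) : ℤ) := by
    rw [mem_torsionFixing_iff]
    intro Q
    obtain ⟨P₀, rfl⟩ := (torsionBaseChangeMap_bijective K W ((2 ^ 1 : ℕ) : ℤ)).2 Q
    rw [← torsionBaseChangeMap_smul, hresF'', mul_smul, hFF]
  -- ### Step 4: the two criteria
  have hIK : 𝔔₀.inertia (absoluteGaloisGroup K) ≤ torsionFixing (W.baseChange K) ((2 ^ 1 : ℕ) : ℤ) :=
    inertia_le_torsionFixing (W.baseChange K) hwbad hqw _ h𝔐K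
  have hopenK := isOpen_torsionFixing (W.baseChange K) hq0Z
  haveI : CharZero (w.adicCompletion K) := charZero_of_injective_algebraMap (algebraMap K (w.adicCompletion K)).injective
  have hsurjK : Function.Surjective (torsionPointsMap (W.baseChange K) (w.adicCompletion K) ((2 ^ 1 : ℕ) : ℤ)) :=
    (torsionPointsMap_bijective (W.baseChange K) (w.adicCompletion K) hq0).2
  have hySel : resTorsion W K ((2 ^ 1 : ℕ) : ℤ) x ∈ selmerLocalKer (W.baseChange K) (w.adicCompletion K) ((2 ^ 1 : ℕ) : ℤ) :=
    resTorsion_mem_selmerLocalKer W K v w _ hgood hqv hxSel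
  have hyunr : c' • resTorsion W K ((2 ^ 1 : ℕ) : ℤ) x ∈ unramifiedKer (geomTorsion (W.baseChange K) ((2 ^ 1 : ℕ) : ℤ)) 𝔔₀ := by
    rw [← (W.baseChange K).selmerLocalKer_eq_unramifiedKer hgoodK hqw h𝔔₀]
    exact AddSubgroup.zsmul_mem _ hySel c'
  have hKcrit := mem_torsionLocalKer_iff_h1Eval_eq_zero (W.baseChange K) ((2 ^ 1 : ℕ) : ℤ) h𝔐K hFrob' hF'fix hIK hopenK hsurjK hyunr
  -- (ℚ side) at `𝔓₀ = g • 𝔓₁` with the Frobenius `g F g⁻¹`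
  obtain ⟨g, hg⟩ := HeightOneSpectrum.exists_smul_eq_of_mem_primesAbove_holds h𝔓₁ h𝔓₀
  have hFrob₀ : IsArithFrobAt (𝓞 ℚ) (g * F * g⁻¹) 𝔓₀ := hg ▸ hFrob.conj g
  obtain ⟨hFF₀, hPM₀, hgen₀, hfree₀⟩ := exists_regular_generator_conj W hFF hPM hgenF hfreeF g
  have hIQ : 𝔓₀.inertia (absoluteGaloisGroup ℚ) ≤ torsionFixing W ((2 ^ 1 : ℕ) : ℤ) := inertia_le_torsionFixing W hvbad hqv _ h𝔐
  have hopenQ := isOpen_torsionFixing W hq0Z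
  have hxunr : x ∈ unramifiedKer (geomTorsion W ((2 ^ 1 : ℕ) : ℤ)) 𝔓₀ := by
    rw [← W.selmerLocalKer_eq_unramifiedKer hgood hqv h𝔓₀]; exact hxSel
  haveI : CharZero (v.adicCompletion ℚ) := charZero_of_injective_algebraMap (algebraMap ℚ (v.adicCompletion ℚ)).injective
  have hsurjQ : Function.Surjective (@torsionPointsMap ℚ _ W (v.adicCompletion ℚ) _
      (HeightOneSpectrum.instAlgebraAdicCompletion (𝓞 ℚ) ℚ v) ((2 ^ 1 : ℕ) : ℤ)) :=
    (@torsionPointsMap_bijective ℚ _ _ W _ (v.adicCompletion ℚ) _ (HeightOneSpectrum.instAlgebraAdicCompletion (𝓞 ℚ) ℚ v) _ (2 ^ 1) hq0).2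
  have hQcrit := zsmul_mem_torsionLocalKer_iff_norm W h𝔐 hFrob₀ hIQ hopenQ hsurjQ hFF₀ hPM₀ hgen₀ hfree₀ hxunr c'
  -- ### Step 5: the link
  have hnorm : h1Eval W ((2 ^ 1 : ℕ) : ℤ) x (g * F * g⁻¹) + (g * F * g⁻¹) • h1Eval W ((2 ^ 1 : ℕ) : ℤ) x (g * F * g⁻¹) =
      g • h1Eval W ((2 ^ 1 : ℕ) : ℤ) x (F * F) := by
    rw [← h1Eval_mul_smul, show g * F * g⁻¹ * (g * F * g⁻¹) = g * (F * F) * g⁻¹ by group, h1Eval_conj W ((2 ^ 1 : ℕ) : ℤ) x g hF2fix]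
  have hθeval : h1Eval (W.baseChange K) ((2 ^ 1 : ℕ) : ℤ) (c' • resTorsion W K ((2 ^ 1 : ℕ) : ℤ) x) F' =
      torsionBaseChangeMap W K ((2 ^ 1 : ℕ) : ℤ) (c' • h1Eval W ((2 ^ 1 : ℕ) : ℤ) x (F * F)) := by
    rw [h1Eval_zsmul _ _ _ _ hF'fix, h1Eval_resTorsion_eq W K _ x hF'fix, hresF'', map_zsmul]
  rw [hQcrit, hKcrit, hnorm, hθeval, smul_comm c' g, smul_eq_zero_iff_eq, map_eq_zero_iff _ (torsionBaseChangeMap_injective W K _)]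

/-- **The transposition-prime dictionary WITHOUT the Selmer hypothesis** (`ℓ ∤ c`): for EVERY `x ∈ H¹(ℚ, E[2])` and `c'`:
`c'·x ∈ torsionLocalKer_ℓ ⟺ c'·res x ∈ torsionLocalKer_λ` (both sides force `c'·x` Selmer at `ℓ`, as in gk2-p3's `…_of_notMem`).
[cite: McCallumLMS1991, §4 Prop. 4.4] [cite: GrossLMS1991, Prop. 9.6] [cite: Kramer1981, Prop. 3] -/
theorem zsmul_mem_torsionLocalKer_iff_resTorsion_of_jacobiSym_of_notMem {q : ℕ} (hq : q = 2 ^ 1) {ℓ : ℕ} (hℓ : ℓ.Prime) (hℓ2 : ℓ ≠ 2)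
    {v : HeightOneSpectrum (𝓞 ℚ)} (hℓv : (ℓ : 𝓞 ℚ) ∈ v.asIdeal) (hgood : W.HasGoodReductionAt v)
    (hℓΔ : ¬ (ℓ : ℤ) ∣ W.Δ.num) (hjac : jacobiSym W.Δ.num ℓ = -1)
    (h2K : Module.finrank ℚ K = 2) {θ : K} (hθ : θ ∉ (algebraMap ℚ K).range) {c : ℤ} (hc : θ ^ 2 = algebraMap ℚ K c)
    (hcv : ((c : ℤ) : 𝓞 ℚ) ∉ v.asIdeal)
    (w : HeightOneSpectrum (𝓞 K)) [w.asIdeal.LiesOver v.asIdeal] (hf : w.asIdeal.inertiaDeg (𝓞 ℚ) = 2)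
    (x : galH1Torsion W (q : ℤ)) (c' : ℤ) :
    c' • x ∈ W.torsionLocalKer (v.adicCompletion ℚ) (q : ℤ) ↔
      c' • resTorsion W K (q : ℤ) x ∈ (W.baseChange K).torsionLocalKer (w.adicCompletion K) (q : ℤ) := by
  have h2v' : ((2 : ℕ) : 𝓞 ℚ) ∉ v.asIdeal := two_notMem_of_odd_prime_mem hℓ hℓ2 hℓv
  have hqv : ((q : ℤ) : 𝓞 ℚ) ∉ v.asIdeal := by
    rw [Int.cast_natCast, hq, Nat.cast_pow]; exact fun h ↦ h2v' (v.isPrime.mem_of_pow_mem 1 h)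
  have key : c' • x ∈ selmerLocalKer W (v.adicCompletion ℚ) (q : ℤ) →
      (c' • x ∈ W.torsionLocalKer (v.adicCompletion ℚ) (q : ℤ) ↔
        c' • resTorsion W K (q : ℤ) x ∈ (W.baseChange K).torsionLocalKer (w.adicCompletion K) (q : ℤ)) := fun hsel ↦ by
    have h := zsmul_mem_torsionLocalKer_iff_resTorsion_of_jacobiSym W hq hℓ hℓ2 hℓv hgood hℓΔ hjac h2K hθ hc w hf hsel 1
    rwa [one_zsmul, map_zsmul, one_zsmul] at h
  refine ⟨fun h ↦ (key (W.torsionLocalKer_le_selmerLocalKer _ _ h)).mp h, fun h ↦ (key ?_).mpr h⟩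
  refine mem_selmerLocalKer_of_resTorsion_mem_quadratic W h2K hθ hc (q : ℤ) v w hgood hqv (by exact_mod_cast h2v') hcv ?_
  rw [map_zsmul]
  exact (W.baseChange K).torsionLocalKer_le_selmerLocalKer _ _ h

/-! ### §4 The CROSS field over `ℚ` at a transposition prime, from the `K`-relation -/

/-- **Prop. 4.4 over `ℚ` ACROSS at a transposition prime** (`c_mem_loc_iff₁₂` shape, level `2`): `E = W/ℚ` globally minimal, `K = ℚ(θ₀)`
quadratic with `θ₀² = c₀ ∈ ℤ`, twist data `θ² = c ∈ ℚ` (`E^{(c)}_K ≅ E_K`, `hPsiKT`); `ℓ` an odd good prime in `v`, `ℓ ∤ c₀`, `(Δ_min/ℓ) = −1`,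
`E^{(c)}` good at `v`, `w ∣ v` inert; `res u = cK`, `hPsiKT (res y) = cK'`, and the `K`-relation `c'·cK' ∈ Sel_w ↔ c'·cK ∈ Strict_w`.  Then
`c'·y ∈ selmerLocalKer_v(E^{(c)}/ℚ) ⟺ c'·u ∈ torsionLocalKer_v(E/ℚ)` (composition as in gk2-p3's
`zsmul_twist_mem_selmerLocalKer_iff_zsmul_mem_torsionLocalKer_of_K`, the dictionary being §3). [cite: McCallumLMS1991, §4 Prop. 4.4]
[cite: Kolyvagin1989Izv, §3] -/
theorem zsmul_twist_mem_selmerLocalKer_iff_zsmul_mem_torsionLocalKer_of_K_of_jacobiSym {q : ℕ} (hq : q = 2 ^ 1) {ℓ : ℕ}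
    (hℓ : ℓ.Prime) (hℓ2 : ℓ ≠ 2) {v : HeightOneSpectrum (𝓞 ℚ)} (hℓv : (ℓ : 𝓞 ℚ) ∈ v.asIdeal)
    (hgood : W.HasGoodReductionAt v) (hℓΔ : ¬ (ℓ : ℤ) ∣ W.Δ.num) (hjac : jacobiSym W.Δ.num ℓ = -1)
    (h2K : Module.finrank ℚ K = 2) {θ₀ : K} (hθ₀ : θ₀ ∉ (algebraMap ℚ K).range) {c₀ : ℤ} (hc₀ : θ₀ ^ 2 = algebraMap ℚ K c₀)
    (hc₀v : ((c₀ : ℤ) : 𝓞 ℚ) ∉ v.asIdeal)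
    (w : HeightOneSpectrum (𝓞 K)) [w.asIdeal.LiesOver v.asIdeal] (hf : w.asIdeal.inertiaDeg (𝓞 ℚ) = 2)
    {θ : K} {c : ℚ} (hθ : θ ∉ Set.range (algebraMap ℚ K)) (hc : θ ^ 2 = algebraMap ℚ K c)
    [(W.quadraticTwist c).IsElliptic] (hgood' : (W.quadraticTwist c).HasGoodReductionAt v)
    {cK cK' : galH1Torsion (W.baseChange K) (q : ℤ)} {u : galH1Torsion W (q : ℤ)} {y : galH1Torsion (W.quadraticTwist c) (q : ℤ)}
    (hu : resTorsion W K (q : ℤ) u = cK) (hy : hPsiKT W K hθ hc (q : ℤ) (resTorsion (W.quadraticTwist c) K (q : ℤ) y) = cK') (c' : ℤ)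
    (hRel : c' • cK' ∈ selmerLocalKer (W.baseChange K) (w.adicCompletion K) (q : ℤ) ↔
      c' • cK ∈ (W.baseChange K).torsionLocalKer (w.adicCompletion K) (q : ℤ)) :
    c' • y ∈ selmerLocalKer (W.quadraticTwist c) (v.adicCompletion ℚ) (q : ℤ) ↔ c' • u ∈ W.torsionLocalKer (v.adicCompletion ℚ) (q : ℤ) := by
  obtain ⟨h2v, hqv⟩ := two_notMem_and_natCast_two_pow_notMem hq hℓ hℓ2 hℓv
  rw [zsmul_mem_selmerLocalKer_iff_resTorsion (W.quadraticTwist c) h2K hθ₀ hc₀ (q : ℤ) v w hgood' hqv h2v hc₀v y c',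
    zsmul_mem_selmerLocalKer_iff_hPsiKT_mem W K hθ hc (q : ℤ) (w.adicCompletion K) _ c', hy, hRel, ← hu]
  exact (zsmul_mem_torsionLocalKer_iff_resTorsion_of_jacobiSym_of_notMem W hq hℓ hℓ2 hℓv hgood hℓΔ hjac h2K hθ₀ hc₀ hc₀v w hf u c').symm

end Dictionary

end Summit.BirchSwinnertonDyer.BirchSwinnertonDyer.Theorems.RankOneAtTwoOneDoor

end
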